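import Summits.ABC.IUTFork.LDHSplitBadPrimeLargeL
import HarnessLib

/-!
# The fork at [IUTchIII] Corollary 3.12, L-DH level: the EXPLICIT `l`-dependent bad-mass threshold `ℓ⋇·(1 − β)³ ≥ 2`

Proof-only companion (D-0012; 0 definitions, no `Prop` fact) of `LDHSplitBadPrimeLargeL.lean` (abc-iut-w5-d018, p430596); WAVE-5 prover
abc-iut-w5-d018 (gen 4). TAKES NO SIDE on [IUTchIII] Cor. 3.12.

`LDHSplitBadPrimeLargeL` proved: `Σ' n, (n+1)²·β^{n+1} ≤ ℓ⋇` and bad mass `≤ β` at every support prime ⇒ `Cor312NonarchOf ∧ Cor312Of`,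
and the qualitative «for every `β < 1` some `L(β)`». HERE the closed form: `(n+1)² ≤ (n+1)(n+2) = 2·C(n+2, 2)`, and Mathlib's
`Σ_n C(n+2,2)·βⁿ = 1/(1−β)³` (`hasSum_choose_mul_geometric_of_norm_lt_one`) give

* `SplitBadPrime.tsum_sq_mul_pow_le` — `Σ' n, (n+1)²·β^{n+1} ≤ 2β/(1−β)³` for `0 ≤ β < 1`;
* **`ThetaVolumeInput.cor312Of_of_badMass_le_explicit`** — if `0 ≤ β < 1`, `2 ≤ ℓ⋇·(1−β)³` and the bad mass of the genuine Θ-volume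
  input `I` is `≤ β` at every support prime, then `Cor312NonarchOf I ∧ Cor312Of I`. Equivalently: bad mass
  `β_p ≤ 1 − (2/ℓ⋇)^{1/3}` at every support prime suffices — `ℓ⋇ = 2`: `β ≤ 0`; `ℓ⋇ = 16`: `β ≤ 1/2`; `ℓ⋇ = 250`: `β ≤ 4/5`;
  `ℓ⋇ = 2000`: `β ≤ 9/10` (the uniform thresholds `1/3`, `1/2` of abc-iut-c312-3 / p430071 are better for small `l`).

READING (neutral), as in the parent: in the sharp Dupuy–Hilado-level model the FALSE side of the bad-mass fork at prime-level `ℓ⋇` needs a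
support prime with `β_p > 1 − (2/ℓ⋇)^{1/3}`; typed objects ((Ind1) = all capsule-index permutations, R2); no side taken; typed ≠ proved.
[cite: DupuyHilado2025, §3.6, §4.7, §4.12] [cite: Mochizuki2012, IUTchIII Cor. 3.12 p. 173–174] [claim: Mochizuki2012, status: disputed]
-/

noncomputable section

open Finset NumberField IsDedekindDomain Literature.IUT.LogVolume

namespace Summit.ABC.IUTFork

namespace SplitBadPrime

/-- `Σ' n, (n+1)²·β^{n+1} ≤ 2β/(1−β)³` for `0 ≤ β < 1` (`(n+1)² ≤ 2·C(n+2,2)` and `Σ C(n+2,2)βⁿ = (1−β)⁻³`). [folklore] -/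
theorem tsum_sq_mul_pow_le {β : ℝ} (h0 : 0 ≤ β) (h1 : β < 1) :
    ∑' n : ℕ, (((n : ℝ) + 1) ^ 2 * β ^ (n + 1)) ≤ 2 * β / (1 - β) ^ 3 := by
  have hr : ‖β‖ < 1 := by rwa [Real.norm_eq_abs, abs_of_nonneg h0]
  have hG : HasSum (fun n : ℕ => (((n + 2).choose 2 : ℕ) : ℝ) * β ^ n) (1 / (1 - β) ^ 3) :=
    hasSum_choose_mul_geometric_of_norm_lt_one 2 hr
  have hG' : HasSum (fun n : ℕ => (2 * β) * ((((n + 2).choose 2 : ℕ) : ℝ) * β ^ n)) ((2 * β) * (1 / (1 - β) ^ 3)) :=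
    hG.mul_left (2 * β)
  have hF : HasSum (fun n : ℕ => (((n : ℝ) + 1) ^ 2 * β ^ (n + 1)))
      (∑' n : ℕ, (((n : ℝ) + 1) ^ 2 * β ^ (n + 1))) := (summable_sq_mul_pow h0 h1).hasSum
  have hle := hasSum_le (fun n => ?_) hF hG'
  · calc ∑' n : ℕ, (((n : ℝ) + 1) ^ 2 * β ^ (n + 1)) ≤ (2 * β) * (1 / (1 - β) ^ 3) := hle
      _ = 2 * β / (1 - β) ^ 3 := by ring
  · -- `(n+1)² β^{n+1} ≤ 2β·C(n+2,2)·βⁿ = (n+1)(n+2) β^{n+1}`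
    have hc : (((n + 2).choose 2 : ℕ) : ℝ) = ((n : ℝ) + 2) * ((n : ℝ) + 1) / 2 := by
      rw [Nat.cast_choose_two]; push_cast; ring
    rw [hc]
    have hβn : 0 ≤ β ^ (n + 1) := pow_nonneg h0 _
    have hn : (0 : ℝ) ≤ n := Nat.cast_nonneg n
    calc ((n : ℝ) + 1) ^ 2 * β ^ (n + 1) ≤ (((n : ℝ) + 2) * ((n : ℝ) + 1)) * β ^ (n + 1) :=
          mul_le_mul_of_nonneg_right (by nlinarith) hβn
      _ = 2 * β * (((n : ℝ) + 2) * ((n : ℝ) + 1) / 2 * β ^ n) := by ring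

end SplitBadPrime

section Explicit

variable {F₀ : Type} [Field F₀] [NumberField F₀] {K : Type} [Field K] [NumberField K] [Algebra F₀ K]

/-- **Explicit `l`-dependent threshold `ℓ⋇·(1−β)³ ≥ 2`.** If `0 ≤ β < 1`, `2 ≤ ℓ⋇·(1−β)³`, and the bad places of the genuine Θ-volume
input `I` over each support prime carry at most the fraction `β` of `[F₀:ℚ]`, then Dupuy–Hilado's (1.1) (`Cor312NonarchOf`) and
[IUTchIII] Cor. 3.12 as typed (`Cor312Of`) hold for `I` — whatever the depths, `K`, the ideles (`Σ'(n+1)²β^{n+1} ≤ 2β/(1−β)³ ≤ 2/(1−β)³ ≤ ℓ⋇`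
into `cor312Of_of_badMass_le_of_tsum_le`). Typed objects; no side taken on print's Cor. 3.12. [claim: Mochizuki2012, status: disputed]
[cite: DupuyHilado2025, §3.6, §4.7, §4.12] -/
theorem ThetaVolumeInput.cor312Of_of_badMass_le_explicit (I : ThetaVolumeInput F₀ K) {β : ℝ} (h0 : 0 ≤ β) (h1 : β < 1)
    (hL : 2 ≤ (I.lstar : ℝ) * (1 - β) ^ 3)
    (h : ∀ p ∈ I.supportPrimes,
      ∑ v : placesOver F₀ p, (I.X.S : Set (HeightOneSpectrum (𝓞 F₀))).indicator (weight F₀) v.1 ≤ β) :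
    I.Cor312NonarchOf ∧ I.Cor312Of := by
  refine ThetaVolumeInput.cor312Of_of_badMass_le_of_tsum_le I h0 h1 ?_ h
  have hpos : (0 : ℝ) < (1 - β) ^ 3 := pow_pos (by linarith) 3
  refine (SplitBadPrime.tsum_sq_mul_pow_le h0 h1).trans ?_
  rw [div_le_iff₀ hpos]
  nlinarith

end Explicit

end Summit.ABC.IUTFork

end
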